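import Summits.NavierStokesRegularity.NavierStokesRegularity.Theorems.CertifiedBlowupCertifiedBlowupVorticityRateBlowupDissipationBudget
import HarnessLib

/-!
# Certificate class `CertifiedBlowupVorticityRateBlowup` (stmt-NavierStokesRegularity-8639): THE DISSIPATION BUDGET AT THE
# STRAIN VALUE `κ = 2/√3` (witness forms) and the certificate-free rider `liminf (T − t)‖∇u(t)‖₂² = 0`

Theorems file landed `--supports stmt-NavierStokesRegularity-8639` (cell `ns-blowup`, GROUP B zone Z1; companion of the
twelfth crux-side deposit `…VorticityRateBlowupDissipationBudget`, split off by the 400-line rule). For every witness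
`(ν, T, u, p)` of the certificate class and every admissible `C` (`κ = 2/√3` by `slab_gronwall_sharp`; `C > √3/4 > 0` by
deposit 11), eventually as `t → T⁻`: `vorticityRate_witness_enstrophy_typeI_sharp` — `(T − t)∫|ω(t)|² ≤ e(2/√3)C E(u₀)/ν`;
`vorticityRate_witness_velocity_twoThirds_sharp` — `(T − t)²‖u(t, x)‖³ ≤ 8(4π)⁻¹e(2/√3)C² E(u₀)/ν` for all `x`
(**`γ_u ≤ 2/3` for every `C`**); `vorticityRate_witness_gauge_third_sharp` — `(T − t)(ν(T − t)/λ²)³ ≤ K` at every near-max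
scale (deposit 7's KNSS Type-II gauge sequence obeys `dₖ ≲ (T − tₖ)^{−1/3}`). WITHOUT any certificate,
`integral_sq_norm_curl_frequently_lt`: every classical Leray–Hopf solution on `[0, T) × ℝ³` (`ν, T > 0`, rapidly decaying
datum) has, for every `m > 0`, frequently as `t → T⁻`, `(T − t)∫|ω(t)|² < m`; whence under the rate
`vorticityRate_witness_frequently_sq_mul_cube_lt` (`liminf (T − t)²‖u(t)‖³_∞ = 0`). ZONE-Z1 READING:
`γ_u ≤ min((1 + (2/√3)C_ω)/3, 2/3)`, `d ≲ (T − t)^{max((1 − (4/√3)C_ω)/3, −1/3)}`; a candidate printing `‖u‖_∞ ∼ (T − t)^{−γ}`,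
`γ > 2/3`, is outside the certificate class for every `C_ω`. No new definitions, no named-fact hypotheses, no `sorry`.
WHAT THIS IS NOT: not a blow-up or regularity claim — a priori inequalities about a HYPOTHETICAL witness; crux 8639, crux
8640, (AX-L) and the floor `√3/4` are untouched. Author: ns-blowup-profile-eng-1 g13, 2026-08-27.

## References
* P. Constantin, Comm. Math. Phys. 129 (1990), §2 (2.21). [Constantin1990]
* D. Chae, Comm. Math. Phys. 263 (2005), Thm 2.2. [Chae2005]
* A. J. Majda, A. L. Bertozzi, CUP 2002, §4.1.3 (4.30). [MajdaBertozziCUP2002]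
* G. Koch, N. Nadirashvili, G. Seregin, V. Šverák, Acta Math. 203 (2009), Thms 6.1–6.2. [KochNadirashviliSereginSverak2009]
-/

-- the summit and its single problem share the name (D-0017 nested layout)
set_option linter.dupNamespace false

noncomputable section

open MeasureTheory Set Function Filter Topology Metric
open scoped ENNReal NNReal

namespace Summit.NavierStokesRegularity.NavierStokesRegularity.Theorems.CertifiedBlowupVorticityRateBlowup.DissipationBudget

open Literature.Analysis.FluidPDE
open Summit.NavierStokesRegularity.NavierStokesRegularity.Theorems.CertifiedBlowupAxisymBlowup.CompactAmplification
open Summit.NavierStokesRegularity.NavierStokesRegularity.Theorems.CertifiedBlowupVorticityRateBlowup.ConstantFloor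
open Summit.NavierStokesRegularity.NavierStokesRegularity.Theorems.CertifiedBlowupVorticityRateBlowup.SlabFloor

variable {ν T : ℝ} {u : ℝ → EuclideanSpace ℝ (Fin 3) → EuclideanSpace ℝ (Fin 3)}
  {p : ℝ → EuclideanSpace ℝ (Fin 3) → ℝ}

/-- The eventual rate holds on some `[t₀, T) × ℝ³`, `0 ≤ t₀ < T`. [folklore] -/
theorem exists_rate_Ico_of_eventually (hT : 0 < T) {C : ℝ}
    (hrate : ∀ᶠ t in 𝓝[<] T, ∀ x : EuclideanSpace ℝ (Fin 3), (T - t) * ‖curl (u t) x‖ ≤ C) :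
    ∃ t₀ : ℝ, 0 ≤ t₀ ∧ t₀ < T ∧ ∀ t ∈ Ico t₀ T, ∀ x, (T - t) * ‖curl (u t) x‖ ≤ C := by
  obtain ⟨l, hlT, hl⟩ := mem_nhdsLT_iff_exists_Ioo_subset.1 hrate
  have hlT' : l < T := hlT
  exact ⟨max 0 ((l + T) / 2), le_max_left _ _, max_lt hT (by linarith), fun t ht =>
    hl ⟨lt_of_lt_of_le (lt_of_lt_of_le (by linarith) (le_max_right 0 _)) ht.1, ht.2⟩⟩

/-- Late times are eventual: `t ∈ [t₀, T)` and `(T − t)/a ≤ t − t₀` eventually as `t → T⁻` (`a > 0`). [folklore] -/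
theorem eventually_late {t₀ : ℝ} (ht₀T : t₀ < T) {a : ℝ} (ha : 0 < a) :
    ∀ᶠ t in 𝓝[<] T, t ∈ Ico t₀ T ∧ (T - t) / a ≤ t - t₀ := by
  set s : ℝ := (T + a * t₀) / (1 + a) with hs
  have ha1 : 0 < 1 + a := by linarith
  have hsT : s < T := by rw [hs, div_lt_iff₀ ha1]; nlinarith
  have ht₀s : t₀ ≤ s := by rw [hs, le_div_iff₀ ha1]; nlinarith
  filter_upwards [Ioo_mem_nhdsLT hsT] with t ht
  refine ⟨⟨ht₀s.trans ht.1.le, ht.2⟩, ?_⟩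
  have h : T + a * t₀ < t * (1 + a) := by have hst := ht.1; rwa [hs, div_lt_iff₀ ha1] at hst
  rw [div_le_iff₀ ha]; nlinarith

/-- **CERTIFICATE-CLASS WITNESSES: THE ENSTROPHY IS TYPE I.** For every witness `(ν, T, u, p)` of the certificate class
and every `C` with `(T − t)‖curl u(t, x)‖ ≤ C` near `T⁻`: eventually as `t → T⁻`, `(T − t)∫|curl u(t)|² ≤ e(2/√3)C E(u₀)/ν`
(`slab_gronwall_sharp`, `κ = 2/√3`; `C > √3/4 > 0` by deposit 11). With Leray's floor the enstrophy exponent of the class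
lies in `[1/2, min((2/√3)C, 1)]`. [cite: Constantin1990, §2 eq. (2.21); Chae2005, Thm 2.2; Leray1934, §20 (3.12)] -/
theorem vorticityRate_witness_enstrophy_typeI_sharp (hν : 0 < ν) (hT : 0 < T)
    (hmax : IsMaximalSmoothSolution ν 0 u p T) (hLH : IsLerayHopfOn T ν 0 (u 0) u)
    (hdec : HasRapidSpatialDecay (u 0)) (haxi : IsAxisymmetric (u 0)) {C : ℝ}
    (hrate : ∀ᶠ t in 𝓝[<] T, ∀ x : EuclideanSpace ℝ (Fin 3), (T - t) * ‖curl (u t) x‖ ≤ C) :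
    ∀ᶠ t in 𝓝[<] T, (T - t) * ∫ x, ‖curl (u t) x‖ ^ 2 ≤
      Real.exp 1 * (2 / Real.sqrt 3) * C * VectorCalculus.kineticEnergy (u 0) / ν := by
  have hreg := hasBoundedSobolevNormsOn_before_of_lerayHopf_classical hν hT hmax.1 hLH hdec
  have hC : 0 < C := lt_of_le_of_lt (by positivity)
    (vorticityRate_witness_const_gt_sqrt3_div_four hν hT hmax hLH hdec haxi hrate)
  obtain ⟨t₀, ht₀, ht₀T, hω⟩ := exists_rate_Ico_of_eventually hT hrate
  filter_upwards [eventually_late ht₀T (mul_pos two_div_sqrt_three_pos hC)] with t ht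
  exact mul_integral_sq_norm_curl_le_of_slab hν hT hmax.1 hLH hdec two_div_sqrt_three_pos
    (slab_gronwall_sharp hν hmax.1 hreg) hC ht₀ hω ht.1 ht.2

/-- **CERTIFICATE-CLASS WITNESSES: THE VELOCITY RATE EXPONENT IS AT MOST `2/3`.** For every witness and admissible `C`:
eventually as `t → T⁻`, `(T − t)²‖u(t, x)‖³ ≤ 8(4π)⁻¹ e (2/√3) C² E(u₀)/ν` for all `x` (so `γ_u ≤ min((1 + (2/√3)C_ω)/3, 2/3)`).
[cite: MajdaBertozziCUP2002, §4.1.3 (4.30); Constantin1990, §2 eq. (2.21)] -/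
theorem vorticityRate_witness_velocity_twoThirds_sharp (hν : 0 < ν) (hT : 0 < T)
    (hmax : IsMaximalSmoothSolution ν 0 u p T) (hLH : IsLerayHopfOn T ν 0 (u 0) u)
    (hdec : HasRapidSpatialDecay (u 0)) (haxi : IsAxisymmetric (u 0)) {C : ℝ}
    (hrate : ∀ᶠ t in 𝓝[<] T, ∀ x : EuclideanSpace ℝ (Fin 3), (T - t) * ‖curl (u t) x‖ ≤ C) :
    ∀ᶠ t in 𝓝[<] T, ∀ x : EuclideanSpace ℝ (Fin 3), (T - t) ^ 2 * ‖u t x‖ ^ 3 ≤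
      8 * (4 * Real.pi)⁻¹ * (Real.exp 1 * (2 / Real.sqrt 3) * C ^ 2 * VectorCalculus.kineticEnergy (u 0) / ν) := by
  have hreg := hasBoundedSobolevNormsOn_before_of_lerayHopf_classical hν hT hmax.1 hLH hdec
  have hC : 0 < C := lt_of_le_of_lt (by positivity)
    (vorticityRate_witness_const_gt_sqrt3_div_four hν hT hmax hLH hdec haxi hrate)
  obtain ⟨t₀, ht₀, ht₀T, hω⟩ := exists_rate_Ico_of_eventually hT hrate
  filter_upwards [eventually_late ht₀T (mul_pos two_div_sqrt_three_pos hC)] with t ht x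
  exact sq_mul_cube_norm_le_of_slab hν hT hmax.1 hLH hdec two_div_sqrt_three_pos
    (slab_gronwall_sharp hν hmax.1 hreg) hC ht₀ hω ht.1 ht.2 x

/-- **CERTIFICATE-CLASS WITNESSES: `dₖ ≲ (T − tₖ)^{−1/3}` ALONG EVERY NEAR-MAX GAUGE SEQUENCE.** Some `K ≥ 0` has,
eventually as `t → T⁻`, `(T − t)(ν(T − t)/λ²)³ ≤ K` for every scale `λ > 0` and point with `(λ/ν)‖u(t, x)‖ ≥ 1/2`; so
deposit 7's KNSS Type-II gauge sequence (`ν(T − tₖ)/λₖ² → ∞`) diverges no faster than `(T − tₖ)^{−1/3}`.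
[cite: KochNadirashviliSereginSverak2009, Thms 6.1–6.2; Constantin1990, §2 eq. (2.21)] -/
theorem vorticityRate_witness_gauge_third_sharp (hν : 0 < ν) (hT : 0 < T)
    (hmax : IsMaximalSmoothSolution ν 0 u p T) (hLH : IsLerayHopfOn T ν 0 (u 0) u)
    (hdec : HasRapidSpatialDecay (u 0)) (haxi : IsAxisymmetric (u 0)) {C : ℝ}
    (hrate : ∀ᶠ t in 𝓝[<] T, ∀ x : EuclideanSpace ℝ (Fin 3), (T - t) * ‖curl (u t) x‖ ≤ C) :
    ∃ K : ℝ, 0 ≤ K ∧ ∀ᶠ t in 𝓝[<] T, ∀ lam : ℝ, 0 < lam → ∀ x : EuclideanSpace ℝ (Fin 3),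
      1 / 2 ≤ lam / ν * ‖u t x‖ → (T - t) * (ν * (T - t) / lam ^ 2) ^ 3 ≤ K := by
  have hreg := hasBoundedSobolevNormsOn_before_of_lerayHopf_classical hν hT hmax.1 hLH hdec
  have hC : 0 < C := lt_of_le_of_lt (by positivity)
    (vorticityRate_witness_const_gt_sqrt3_div_four hν hT hmax hLH hdec haxi hrate)
  obtain ⟨t₀, ht₀, ht₀T, hω⟩ := exists_rate_Ico_of_eventually hT hrate
  refine ⟨64 / ν ^ 3 * (8 * (4 * Real.pi)⁻¹ *
      (Real.exp 1 * (2 / Real.sqrt 3) * C ^ 2 * VectorCalculus.kineticEnergy (u 0) / ν)) ^ 2, by positivity, ?_⟩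
  filter_upwards [eventually_late ht₀T (mul_pos two_div_sqrt_three_pos hC)] with t ht lam hlam x hnear
  exact mul_gauge_vertex_distance_cube_le_of_slab hν hT hmax.1 hLH hdec two_div_sqrt_three_pos
    (slab_gronwall_sharp hν hmax.1 hreg) hC ht₀ hω ht.1 ht.2 hlam hnear

/-- **CERTIFICATE-FREE: `liminf_{t → T⁻} (T − t)∫|ω(t)|² = 0` for every classical Leray–Hopf solution** on `[0, T) × ℝ³`
(`ν, T > 0`, rapidly decaying datum): for every `m > 0`, frequently as `t → T⁻`, `(T − t)∫|curl u(t)|² < m` — otherwise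
`∫|ω(t)|² ≥ m/(T − t)` near `T`, not integrable (`intervalIntegrable_sub_inv_iff`), against the budget `∫₀ᵀ∫|ω|² ≤ E(u₀)/ν`.
[cite: Constantin1990, §2 eq. (2.21); Leray1934, §17 (3.4)] -/
theorem integral_sq_norm_curl_frequently_lt (hν : 0 < ν) (hT : 0 < T)
    (hcl : IsClassicalNSSolutionOn (Ico 0 T) ν 0 u p) (hLH : IsLerayHopfOn T ν 0 (u 0) u)
    (hdec : HasRapidSpatialDecay (u 0)) {m : ℝ} (hm : 0 < m) :
    ∃ᶠ t in 𝓝[<] T, (T - t) * ∫ x, ‖curl (u t) x‖ ^ 2 < m := by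
  by_contra h
  obtain ⟨l, hlT, hl⟩ := mem_nhdsLT_iff_exists_Ioo_subset.1 (Filter.not_frequently.1 h)
  have hlT' : l < T := hlT
  set t₀ : ℝ := max 0 ((l + T) / 2) with ht₀
  have ht₀0 : 0 ≤ t₀ := le_max_left _ _
  have ht₀T : t₀ < T := max_lt hT (by linarith)
  have hlt₀ : l < t₀ := lt_of_lt_of_le (by linarith) (le_max_right _ _)
  have hge : ∀ t ∈ Ioo t₀ T, m / (T - t) ≤ ∫ x, ‖curl (u t) x‖ ^ 2 := fun t ht => by
    rw [div_le_iff₀ (sub_pos.2 ht.2), mul_comm]; exact not_lt.1 (hl ⟨hlt₀.trans ht.1, ht.2⟩)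
  have hfin : ∫⁻ t in Ioo t₀ T, ENNReal.ofReal (m / (T - t)) < ⊤ := by
    refine lt_of_le_of_lt ?_ (lt_of_le_of_lt (lintegral_Ioo_enstrophy_le hν hT hcl hLH hdec ht₀0 le_rfl)
      ENNReal.ofReal_lt_top)
    exact setLIntegral_mono' measurableSet_Ioo fun t ht => ENNReal.ofReal_le_ofReal (hge t ht)
  -- so `t ↦ (t − T)⁻¹` would be interval integrable on `[t₀, T]`: absurd
  have hcont : ContinuousOn (fun t : ℝ => m / (T - t)) (Ioo t₀ T) :=
    continuousOn_const.div (continuousOn_const.sub continuousOn_id) fun t ht => (sub_pos.2 ht.2).ne'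
  have hInt : IntegrableOn (fun t : ℝ => m / (T - t)) (Ioo t₀ T) := by
    refine ⟨hcont.aestronglyMeasurable measurableSet_Ioo, ?_⟩
    rw [HasFiniteIntegral]
    refine lt_of_le_of_lt (le_of_eq (lintegral_congr_ae ?_)) hfin
    filter_upwards [ae_restrict_mem measurableSet_Ioo] with t ht
    rw [← ofReal_norm, Real.norm_of_nonneg (div_nonneg hm.le (sub_pos.2 ht.2).le)]
  have hII : IntervalIntegrable (fun t : ℝ => (t - T)⁻¹) volume t₀ T := by
    have h1 : IntervalIntegrable (fun t : ℝ => m / (T - t)) volume t₀ T :=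
      (intervalIntegrable_iff_integrableOn_Ioo_of_le ht₀T.le).2 hInt
    have h2 := h1.const_mul (-m⁻¹)
    refine h2.congr fun t _ => ?_
    have hm' : m ≠ 0 := hm.ne'
    rcases eq_or_ne t T with rfl | htT
    · simp
    · have : T - t ≠ 0 := sub_ne_zero.2 (Ne.symm htT)
      have : t - T ≠ 0 := sub_ne_zero.2 htT
      field_simp; ring
  rcases intervalIntegrable_sub_inv_iff.1 hII with h1 | h2
  · exact absurd h1 ht₀T.ne
  · exact h2 right_mem_uIcc

/-- **Under the rate: `liminf_{t → T⁻} (T − t)²‖u(t)‖³_∞ = 0`** — for every `ε > 0`, frequently as `t → T⁻`,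
`(T − t)²‖u(t, x)‖³ < ε` for ALL `x` (slice Biot–Savart at the times of `integral_sq_norm_curl_frequently_lt`; no symmetry).
[cite: MajdaBertozziCUP2002, §4.1.3 (4.30); Constantin1990, §2 eq. (2.21)] -/
theorem vorticityRate_witness_frequently_sq_mul_cube_lt (hν : 0 < ν) (hT : 0 < T)
    (hcl : IsClassicalNSSolutionOn (Ico 0 T) ν 0 u p) (hLH : IsLerayHopfOn T ν 0 (u 0) u)
    (hdec : HasRapidSpatialDecay (u 0)) {C : ℝ}
    (hrate : ∀ᶠ t in 𝓝[<] T, ∀ x : EuclideanSpace ℝ (Fin 3), (T - t) * ‖curl (u t) x‖ ≤ C) {ε : ℝ} (hε : 0 < ε) :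
    ∃ᶠ t in 𝓝[<] T, ∀ x : EuclideanSpace ℝ (Fin 3), (T - t) ^ 2 * ‖u t x‖ ^ 3 < ε := by
  have hreg := hasBoundedSobolevNormsOn_before_of_lerayHopf_classical hν hT hcl hLH hdec
  obtain ⟨t₀, ht₀, ht₀T, hω⟩ := exists_rate_Ico_of_eventually hT hrate
  have hC0 : 0 ≤ C := le_trans (mul_nonneg (sub_pos.2 ht₀T).le (norm_nonneg _)) (hω t₀ ⟨le_rfl, ht₀T⟩ 0)
  set m : ℝ := ε / (8 * (4 * Real.pi)⁻¹ * C + 1) with hm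
  have hden : 0 < 8 * (4 * Real.pi)⁻¹ * C + 1 := by positivity
  have hm0 : 0 < m := div_pos hε hden
  have hfreq := integral_sq_norm_curl_frequently_lt hν hT hcl hLH hdec hm0
  have hev : ∀ᶠ t in 𝓝[<] T, t ∈ Ico t₀ T := eventually_of_mem (Ioo_mem_nhdsLT ht₀T) fun t ht => ⟨ht.1.le, ht.2⟩
  refine (hfreq.and_eventually hev).mono fun t ⟨hlt, htI⟩ x => ?_
  have hTt : 0 < T - t := sub_pos.2 htI.2
  have hΩ : ∀ y, ‖curl (u t) y‖ ≤ C / (T - t) := fun y => by rw [le_div_iff₀ hTt, mul_comm]; exact hω t htI y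
  have hcube := cube_norm_le_of_norm_curl_le hcl hreg ⟨ht₀.trans htI.1, htI.2⟩ hΩ x
  calc (T - t) ^ 2 * ‖u t x‖ ^ 3 ≤ (T - t) ^ 2 * (8 * (4 * Real.pi)⁻¹ * (C / (T - t)) * ∫ y, ‖curl (u t) y‖ ^ 2) :=
        mul_le_mul_of_nonneg_left hcube (sq_nonneg _)
    _ = 8 * (4 * Real.pi)⁻¹ * C * ((T - t) * ∫ y, ‖curl (u t) y‖ ^ 2) := by
        field_simp
    _ ≤ 8 * (4 * Real.pi)⁻¹ * C * m := mul_le_mul_of_nonneg_left hlt.le (by positivity)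
    _ < ε := by
        rw [hm, ← mul_div_assoc, div_lt_iff₀ hden]
        nlinarith [hε]

/-! ### APPEND (eng-1 g13, same session): THE TAIL OF THE BUDGET — the caps are LITTLE-o -/

/-- **The window inequality against an arbitrary window budget.** Under the slab Grönwall `(S_κ)`, `κ ≥ 0`, and the rate
`(T − t)‖curl u(t, x)‖ ≤ C` on `[t₀, T)` (`t₀ ≥ 0`): for `t₀ ≤ t₁ < t₂ < T` and `M ≥ 0` with
`∫_{t₁}^{t₂} (∫|curl u(t)|²) dt ≤ M` (lower Lebesgue integral in time), `(t₂ − t₁) ∫|curl u(t₂)|² ≤ M · exp(κC(t₂ − t₁)/(T − t₂))`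
— the proof of `window_mul_integral_sq_norm_curl_le_of_slab` with the energy budget replaced by `M`; nothing about the
equation is used beyond `(S_κ)` and the rate. [new here — elementary] -/
theorem window_mul_integral_sq_norm_curl_le_of_lintegral_le {κ : ℝ} (hκ : 0 ≤ κ)
    (hslab : ∀ ⦃t₁ t₂ Ω : ℝ⦄, 0 ≤ t₁ → t₁ < t₂ → t₂ < T → (∀ t ∈ Icc t₁ t₂, ∀ x, ‖curl (u t) x‖ ≤ Ω) →
      ∫ x, ‖curl (u t₂) x‖ ^ 2 ≤ (∫ x, ‖curl (u t₁) x‖ ^ 2) * Real.exp (κ * Ω * (t₂ - t₁)))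
    {C t₀ : ℝ} (ht₀ : 0 ≤ t₀) (hω : ∀ t ∈ Ico t₀ T, ∀ x, (T - t) * ‖curl (u t) x‖ ≤ C)
    {t₁ t₂ M : ℝ} (h01 : t₀ ≤ t₁) (h12 : t₁ < t₂) (h2T : t₂ < T) (hM : 0 ≤ M)
    (hbud : ∫⁻ t in Ioo t₁ t₂, ENNReal.ofReal (∫ x, ‖curl (u t) x‖ ^ 2) ≤ ENNReal.ofReal M) :
    (t₂ - t₁) * ∫ x, ‖curl (u t₂) x‖ ^ 2 ≤ M * Real.exp (κ * C * (t₂ - t₁) / (T - t₂)) := by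
  have hTt₂ : 0 < T - t₂ := sub_pos.2 h2T
  have ht₁0 : 0 ≤ t₁ := ht₀.trans h01
  have hC0 : 0 ≤ C :=
    le_trans (mul_nonneg hTt₂.le (norm_nonneg _)) (hω t₂ ⟨h01.trans h12.le, h2T⟩ 0)
  set E₂ : ℝ := ∫ x, ‖curl (u t₂) x‖ ^ 2 with hE₂
  have hE₂0 : 0 ≤ E₂ := integral_nonneg fun x => sq_nonneg _
  set Ω : ℝ := C / (T - t₂) with hΩ
  have hΩ0 : 0 ≤ Ω := div_nonneg hC0 hTt₂.le
  have hωwin : ∀ t ∈ Icc t₁ t₂, ∀ x, ‖curl (u t) x‖ ≤ Ω := by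
    intro t ht x
    have h := hω t ⟨h01.trans ht.1, lt_of_le_of_lt ht.2 h2T⟩ x
    rw [hΩ, le_div_iff₀ hTt₂]
    calc ‖curl (u t) x‖ * (T - t₂) ≤ ‖curl (u t) x‖ * (T - t) :=
          mul_le_mul_of_nonneg_left (by linarith [ht.2]) (norm_nonneg _)
      _ = (T - t) * ‖curl (u t) x‖ := mul_comm _ _
      _ ≤ C := h
  set m : ℝ := E₂ * Real.exp (-(κ * Ω * (t₂ - t₁))) with hm
  have hm0 : 0 ≤ m := mul_nonneg hE₂0 (Real.exp_nonneg _)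
  have hlow : ∀ t ∈ Ioo t₁ t₂, m ≤ ∫ x, ‖curl (u t) x‖ ^ 2 := by
    intro t ht
    have hEt0 : 0 ≤ ∫ x, ‖curl (u t) x‖ ^ 2 := integral_nonneg fun x => sq_nonneg _
    have hs := hslab (ht₁0.trans ht.1.le) ht.2 h2T (fun s hs x => hωwin s ⟨ht.1.le.trans hs.1, hs.2⟩ x)
    have hexp : Real.exp (κ * Ω * (t₂ - t)) ≤ Real.exp (κ * Ω * (t₂ - t₁)) :=
      Real.exp_le_exp.2 (mul_le_mul_of_nonneg_left (by linarith [ht.1]) (mul_nonneg hκ hΩ0))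
    have h1 : E₂ ≤ (∫ x, ‖curl (u t) x‖ ^ 2) * Real.exp (κ * Ω * (t₂ - t₁)) :=
      hs.trans (mul_le_mul_of_nonneg_left hexp hEt0)
    rw [hm, Real.exp_neg, ← div_eq_mul_inv, div_le_iff₀ (Real.exp_pos _)]
    exact h1
  have hint : ENNReal.ofReal m * ENNReal.ofReal (t₂ - t₁) ≤ ENNReal.ofReal M := by
    calc ENNReal.ofReal m * ENNReal.ofReal (t₂ - t₁)
        = ∫⁻ _ in Ioo t₁ t₂, ENNReal.ofReal m := by rw [setLIntegral_const, Real.volume_Ioo]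
      _ ≤ ∫⁻ t in Ioo t₁ t₂, ENNReal.ofReal (∫ x, ‖curl (u t) x‖ ^ 2) :=
          setLIntegral_mono' measurableSet_Ioo fun t ht => ENNReal.ofReal_le_ofReal (hlow t ht)
      _ ≤ ENNReal.ofReal M := hbud
  rw [← ENNReal.ofReal_mul hm0, ENNReal.ofReal_le_ofReal_iff hM] at hint
  have hexp_eq : Real.exp (κ * C * (t₂ - t₁) / (T - t₂)) = Real.exp (κ * Ω * (t₂ - t₁)) := by
    rw [hΩ]; congr 1; field_simp
  rw [hexp_eq]
  calc (t₂ - t₁) * E₂ = m * (t₂ - t₁) * Real.exp (κ * Ω * (t₂ - t₁)) := by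
        rw [hm, Real.exp_neg]; field_simp
    _ ≤ M * Real.exp (κ * Ω * (t₂ - t₁)) := mul_le_mul_of_nonneg_right hint (Real.exp_nonneg _)

/-- **The tail of the budget vanishes.** For a classical Leray–Hopf solution on `[0, T) × ℝ³` (`ν, T > 0`, rapidly decaying
datum): `∫_{t₁}^{T} (∫|curl u(t)|²) dt → 0` as `t₁ → T⁻` — the time integral over `(0, T)` is finite
(`lintegral_Ioo_enstrophy_le`), and the integral over a vanishing set tends to zero (`tendsto_setLIntegral_zero`).
[cite: Constantin1990, §2 eq. (2.21)] -/
theorem tendsto_lintegral_Ioo_enstrophy (hν : 0 < ν) (hT : 0 < T)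
    (hcl : IsClassicalNSSolutionOn (Ico 0 T) ν 0 u p) (hLH : IsLerayHopfOn T ν 0 (u 0) u)
    (hdec : HasRapidSpatialDecay (u 0)) :
    Tendsto (fun t₁ => ∫⁻ t in Ioo t₁ T, ENNReal.ofReal (∫ x, ‖curl (u t) x‖ ^ 2)) (𝓝[<] T) (𝓝 0) := by
  set g : ℝ → ℝ≥0∞ := fun t => ENNReal.ofReal (∫ x, ‖curl (u t) x‖ ^ 2) with hg
  set μ : Measure ℝ := volume.restrict (Ioo 0 T) with hμ
  have hfin : ∫⁻ t, g t ∂μ ≠ ⊤ :=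
    (lt_of_le_of_lt (lintegral_Ioo_enstrophy_le hν hT hcl hLH hdec le_rfl le_rfl) ENNReal.ofReal_lt_top).ne
  -- the measure of the tail window tends to zero
  have hmeas : Tendsto (μ ∘ fun t₁ => Ioo t₁ T) (𝓝[<] T) (𝓝 0) := by
    have hup : Tendsto (fun t₁ : ℝ => ENNReal.ofReal (T - t₁)) (𝓝[<] T) (𝓝 0) := by
      rw [← ENNReal.ofReal_zero]
      refine ENNReal.tendsto_ofReal ?_
      have h : Tendsto (fun t₁ : ℝ => T - t₁) (𝓝 T) (𝓝 (T - T)) := tendsto_const_nhds.sub tendsto_id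
      rw [sub_self] at h
      exact h.mono_left nhdsWithin_le_nhds
    refine tendsto_of_tendsto_of_tendsto_of_le_of_le tendsto_const_nhds hup (fun _ => zero_le) fun t₁ => ?_
    show μ (Ioo t₁ T) ≤ ENNReal.ofReal (T - t₁)
    calc μ (Ioo t₁ T) ≤ volume (Ioo t₁ T) := Measure.restrict_le_self _
      _ = ENNReal.ofReal (T - t₁) := Real.volume_Ioo
  have h := tendsto_setLIntegral_zero hfin hmeas
  -- for `t₁ ≥ 0` the restricted tail integral is the tail integral
  refine h.congr' ?_
  filter_upwards [Ioo_mem_nhdsLT hT] with t₁ ht₁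
  show ∫⁻ t in Ioo t₁ T, g t ∂μ = ∫⁻ t in Ioo t₁ T, g t
  rw [hμ, Measure.restrict_restrict measurableSet_Ioo,
    inter_eq_self_of_subset_left (Ioo_subset_Ioo_left ht₁.1.le)]

/-- **SUB-TYPE-I ENSTROPHY: `(T − t) ∫|curl u(t)|² → 0` as `t → T⁻`** for a classical Leray–Hopf solution on `[0, T) × ℝ³`
(`ν, T > 0`, rapidly decaying datum) with the slab Grönwall `(S_κ)`, `κ > 0`, and the rate `(T − t)‖curl u(t, x)‖ ≤ C` on
`[t₀, T)`, `C > 0`: the window inequality with the TAIL budget `∫_{t₁}^{T}∫|ω|² → 0` in place of `E(u₀)/ν` — the Type-I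
constant `e κ C E(u₀)/ν` of `mul_integral_sq_norm_curl_le_of_slab` improves to `e κ C · (tail)`, which vanishes.
[new here — elementary] -/
theorem tendsto_mul_integral_sq_norm_curl_of_slab (hν : 0 < ν) (hT : 0 < T)
    (hcl : IsClassicalNSSolutionOn (Ico 0 T) ν 0 u p) (hLH : IsLerayHopfOn T ν 0 (u 0) u)
    (hdec : HasRapidSpatialDecay (u 0)) {κ : ℝ} (hκ : 0 < κ)
    (hslab : ∀ ⦃t₁ t₂ Ω : ℝ⦄, 0 ≤ t₁ → t₁ < t₂ → t₂ < T → (∀ t ∈ Icc t₁ t₂, ∀ x, ‖curl (u t) x‖ ≤ Ω) →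
      ∫ x, ‖curl (u t₂) x‖ ^ 2 ≤ (∫ x, ‖curl (u t₁) x‖ ^ 2) * Real.exp (κ * Ω * (t₂ - t₁)))
    {C t₀ : ℝ} (hC : 0 < C) (ht₀ : 0 ≤ t₀) (ht₀T : t₀ < T)
    (hω : ∀ t ∈ Ico t₀ T, ∀ x, (T - t) * ‖curl (u t) x‖ ≤ C) :
    Tendsto (fun t => (T - t) * ∫ x, ‖curl (u t) x‖ ^ 2) (𝓝[<] T) (𝓝 0) := by
  have hκC : 0 < κ * C := mul_pos hκ hC
  rw [Metric.tendsto_nhds]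
  intro ε hε
  -- a tail window `[t₁, T)` whose budget is `≤ M`, `e κ C M = ε/2`
  set M : ℝ := ε / (2 * (Real.exp 1 * (κ * C))) with hM
  have hM0 : 0 < M := by positivity
  have htail := tendsto_lintegral_Ioo_enstrophy hν hT hcl hLH hdec
  have hevM : ∀ᶠ t₁ in 𝓝[<] T, ∫⁻ t in Ioo t₁ T, ENNReal.ofReal (∫ x, ‖curl (u t) x‖ ^ 2) ≤ ENNReal.ofReal M :=
    (htail.eventually (ge_mem_nhds (ENNReal.ofReal_pos.2 hM0)))
  have hev0 : ∀ᶠ t₁ in 𝓝[<] T, t₁ ∈ Ico t₀ T := eventually_of_mem (Ioo_mem_nhdsLT ht₀T) fun t ht => ⟨ht.1.le, ht.2⟩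
  obtain ⟨t₁, ht₁M, ht₁⟩ := (hevM.and hev0).exists
  -- late times with respect to `t₁`
  filter_upwards [eventually_late ht₁.2 hκC] with t ht
  obtain ⟨htI, hlate⟩ := ht
  have hTt : 0 < T - t := sub_pos.2 htI.2
  set θ : ℝ := (T - t) / (κ * C) with hθ
  have hθ0 : 0 < θ := div_pos hTt hκC
  have hbud : ∫⁻ s in Ioo (t - θ) t, ENNReal.ofReal (∫ x, ‖curl (u s) x‖ ^ 2) ≤ ENNReal.ofReal M :=
    (lintegral_mono_set (Ioo_subset_Ioo (by linarith) htI.2.le)).trans ht₁M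
  have hwin := window_mul_integral_sq_norm_curl_le_of_lintegral_le hκ.le hslab ht₀ hω (t₁ := t - θ) (t₂ := t)
    (by linarith [ht₁.1]) (by linarith) htI.2 hM0.le hbud
  have hone : κ * C * θ / (T - t) = 1 := by rw [hθ]; field_simp
  rw [sub_sub_cancel, hone] at hwin
  have hE0 : 0 ≤ ∫ x, ‖curl (u t) x‖ ^ 2 := integral_nonneg fun x => sq_nonneg _
  rw [Real.dist_eq, sub_zero, abs_of_nonneg (mul_nonneg hTt.le hE0)]
  calc (T - t) * ∫ x, ‖curl (u t) x‖ ^ 2 = κ * C * (θ * ∫ x, ‖curl (u t) x‖ ^ 2) := by rw [hθ]; field_simp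
    _ ≤ κ * C * (M * Real.exp 1) := mul_le_mul_of_nonneg_left hwin hκC.le
    _ = ε / 2 := by rw [hM]; field_simp
    _ < ε := by linarith

/-- **SUB-`2/3` VELOCITY: `sup_x (T − t)²‖u(t, x)‖³ → 0`** in the same setting — for every `ε > 0`, eventually as
`t → T⁻`, `(T − t)²‖u(t, x)‖³ ≤ ε` for ALL `x` (slice Biot–Savart: `(T − t)²‖u‖³ ≤ 8(4π)⁻¹ C (T − t)∫|ω(t)|²`).
[cite: MajdaBertozziCUP2002, §4.1.3 (4.30)] -/
theorem eventually_sq_mul_cube_norm_le_of_slab (hν : 0 < ν) (hT : 0 < T)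
    (hcl : IsClassicalNSSolutionOn (Ico 0 T) ν 0 u p) (hLH : IsLerayHopfOn T ν 0 (u 0) u)
    (hdec : HasRapidSpatialDecay (u 0)) {κ : ℝ} (hκ : 0 < κ)
    (hslab : ∀ ⦃t₁ t₂ Ω : ℝ⦄, 0 ≤ t₁ → t₁ < t₂ → t₂ < T → (∀ t ∈ Icc t₁ t₂, ∀ x, ‖curl (u t) x‖ ≤ Ω) →
      ∫ x, ‖curl (u t₂) x‖ ^ 2 ≤ (∫ x, ‖curl (u t₁) x‖ ^ 2) * Real.exp (κ * Ω * (t₂ - t₁)))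
    {C t₀ : ℝ} (hC : 0 < C) (ht₀ : 0 ≤ t₀) (ht₀T : t₀ < T)
    (hω : ∀ t ∈ Ico t₀ T, ∀ x, (T - t) * ‖curl (u t) x‖ ≤ C) {ε : ℝ} (hε : 0 < ε) :
    ∀ᶠ t in 𝓝[<] T, ∀ x : EuclideanSpace ℝ (Fin 3), (T - t) ^ 2 * ‖u t x‖ ^ 3 ≤ ε := by
  have hreg := hasBoundedSobolevNormsOn_before_of_lerayHopf_classical hν hT hcl hLH hdec
  have hpos : 0 < ε / (8 * (4 * Real.pi)⁻¹ * C) := by positivity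
  have hten := tendsto_mul_integral_sq_norm_curl_of_slab hν hT hcl hLH hdec hκ hslab hC ht₀ ht₀T hω
  have hev := (Metric.tendsto_nhds.1 hten) _ hpos
  have hev0 : ∀ᶠ t in 𝓝[<] T, t ∈ Ico t₀ T := eventually_of_mem (Ioo_mem_nhdsLT ht₀T) fun t ht => ⟨ht.1.le, ht.2⟩
  filter_upwards [hev, hev0] with t ht htI x
  have hTt : 0 < T - t := sub_pos.2 htI.2
  have hE0 : 0 ≤ ∫ y, ‖curl (u t) y‖ ^ 2 := integral_nonneg fun y => sq_nonneg _
  rw [Real.dist_eq, sub_zero, abs_of_nonneg (mul_nonneg hTt.le hE0)] at ht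
  have hΩ : ∀ y, ‖curl (u t) y‖ ≤ C / (T - t) := fun y => by rw [le_div_iff₀ hTt, mul_comm]; exact hω t htI y
  have hcube := cube_norm_le_of_norm_curl_le hcl hreg ⟨ht₀.trans htI.1, htI.2⟩ hΩ x
  have hc : 0 < 8 * (4 * Real.pi)⁻¹ * C := by positivity
  calc (T - t) ^ 2 * ‖u t x‖ ^ 3 ≤ (T - t) ^ 2 * (8 * (4 * Real.pi)⁻¹ * (C / (T - t)) * ∫ y, ‖curl (u t) y‖ ^ 2) :=
        mul_le_mul_of_nonneg_left hcube (sq_nonneg _)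
    _ = 8 * (4 * Real.pi)⁻¹ * C * ((T - t) * ∫ y, ‖curl (u t) y‖ ^ 2) := by field_simp
    _ ≤ 8 * (4 * Real.pi)⁻¹ * C * (ε / (8 * (4 * Real.pi)⁻¹ * C)) := mul_le_mul_of_nonneg_left ht.le hc.le
    _ = ε := by field_simp

/-- **CERTIFICATE-CLASS WITNESSES: THE ENSTROPHY IS SUB-TYPE-I — `(T − t)∫|curl u(t)|² → 0` as `t → T⁻`.** For every
witness `(ν, T, u, p)` of the certificate class and every `C` with `(T − t)‖curl u(t, x)‖ ≤ C` near `T⁻` (`κ = 2/√3` by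
`slab_gronwall_sharp`; `C > √3/4 > 0` by deposit 11): the enstrophy exponent of the class lies in `[1/2, 1)`, the Type-I
endpoint EXCLUDED in the little-`o` sense. [cite: Constantin1990, §2 eq. (2.21); Chae2005, Thm 2.2; Leray1934, §20 (3.12)] -/
theorem vorticityRate_witness_tendsto_enstrophy (hν : 0 < ν) (hT : 0 < T)
    (hmax : IsMaximalSmoothSolution ν 0 u p T) (hLH : IsLerayHopfOn T ν 0 (u 0) u)
    (hdec : HasRapidSpatialDecay (u 0)) (haxi : IsAxisymmetric (u 0)) {C : ℝ}
    (hrate : ∀ᶠ t in 𝓝[<] T, ∀ x : EuclideanSpace ℝ (Fin 3), (T - t) * ‖curl (u t) x‖ ≤ C) :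
    Tendsto (fun t => (T - t) * ∫ x, ‖curl (u t) x‖ ^ 2) (𝓝[<] T) (𝓝 0) := by
  have hreg := hasBoundedSobolevNormsOn_before_of_lerayHopf_classical hν hT hmax.1 hLH hdec
  have hC : 0 < C := lt_of_le_of_lt (by positivity)
    (vorticityRate_witness_const_gt_sqrt3_div_four hν hT hmax hLH hdec haxi hrate)
  obtain ⟨t₀, ht₀, ht₀T, hω⟩ := exists_rate_Ico_of_eventually hT hrate
  exact tendsto_mul_integral_sq_norm_curl_of_slab hν hT hmax.1 hLH hdec two_div_sqrt_three_pos
    (slab_gronwall_sharp hν hmax.1 hreg) hC ht₀ ht₀T hω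

/-- **CERTIFICATE-CLASS WITNESSES: THE VELOCITY IS SUB-`(T − t)^{−2/3}` — for every `ε > 0`, eventually as `t → T⁻`,
`(T − t)²‖u(t, x)‖³ ≤ ε` for ALL `x`.** ZONE-Z1 READING: `‖u(t)‖_∞ = o((T − t)^{−2/3})`, the dimensionless vertex distance
of every near-max gauge sequence is `o((T − tₖ)^{−1/3})`; a candidate printing `‖u‖_∞ ≳ (T − t)^{−2/3}` is outside the
certificate class for every `C_ω`. [cite: MajdaBertozziCUP2002, §4.1.3 (4.30); Constantin1990, §2 eq. (2.21)] -/
theorem vorticityRate_witness_eventually_sq_mul_cube_le (hν : 0 < ν) (hT : 0 < T)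
    (hmax : IsMaximalSmoothSolution ν 0 u p T) (hLH : IsLerayHopfOn T ν 0 (u 0) u)
    (hdec : HasRapidSpatialDecay (u 0)) (haxi : IsAxisymmetric (u 0)) {C : ℝ}
    (hrate : ∀ᶠ t in 𝓝[<] T, ∀ x : EuclideanSpace ℝ (Fin 3), (T - t) * ‖curl (u t) x‖ ≤ C) {ε : ℝ} (hε : 0 < ε) :
    ∀ᶠ t in 𝓝[<] T, ∀ x : EuclideanSpace ℝ (Fin 3), (T - t) ^ 2 * ‖u t x‖ ^ 3 ≤ ε := by
  have hreg := hasBoundedSobolevNormsOn_before_of_lerayHopf_classical hν hT hmax.1 hLH hdec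
  have hC : 0 < C := lt_of_le_of_lt (by positivity)
    (vorticityRate_witness_const_gt_sqrt3_div_four hν hT hmax hLH hdec haxi hrate)
  obtain ⟨t₀, ht₀, ht₀T, hω⟩ := exists_rate_Ico_of_eventually hT hrate
  exact eventually_sq_mul_cube_norm_le_of_slab hν hT hmax.1 hLH hdec two_div_sqrt_three_pos
    (slab_gronwall_sharp hν hmax.1 hreg) hC ht₀ ht₀T hω hε

end Summit.NavierStokesRegularity.NavierStokesRegularity.Theorems.CertifiedBlowupVorticityRateBlowup.DissipationBudget

end
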